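import Summits.BirchSwinnertonDyer.Rank1Residual.O5.HeegnerLogTransportThreeStepZeroEndRecord
import Summits.BirchSwinnertonDyer.Rank1Residual.O5.HeegnerTwistTamagawaThree
import HarnessLib
import HarnessLib.Audit.Tags

/-!
# O5 (t′) — KL3 END of record with the Tamagawa binder of the twist DELETED for every `d_K`
# (cell `b2b-bsdres`, lane CLASS-CLOSURE, class O5; harvest seat 2 GEN 59, item E116′ END corollary)

HONEST FRAMING (cell `b2b-bsdres`, run/shared/lean/b2b/bsd-rank1-residual/, verbatim in every file): the
goal of the cell is to DELETE the COMBINATION-SHAPED residual classes of the Birch–Swinnerton-Dyer formula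
for ALL analytic-rank `≤ 1` elliptic curves over `ℚ` — "full BSD formula for every rank `≤ 1` curve in
class `C`" assembled STRICTLY from published theorems — so that the rank-`≤ 1` remainder becomes exactly
the CONSTRUCTION-SHAPED classes, which are TYPED (missing-input `Prop`s), NOT attempted. This is not
"finishing BSD". Research route (class O5 = tame potentially-supersingular additive `p = 3` (t′), `9 ‖ N`):
a CONDITIONAL theorem whose displayed inputs are published theorems vendored as named facts + per-pair
binders; nothing booked, no mark / label / count / tier of `RESIDUAL-MAP.md` moves, census = EVIDENCE
(never a Literature fact); O5 stays OPEN as a class. THEOREMS ONLY — 0 `def`, 0 `@[conjecture]`,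
0 Literature facts (net named-fact debt 0), no `sorry`. Unit `b2b-bsdres-harvest-2` GEN 59: the END
corollary announced with E116′ (HOME/INBOX.md l.14309 "the END corollary with `htamGd` deleted … or say
NOT-MINE and I write it as part 20", l.14380 (3), l.14422).

## What this file does

o5-r2 GEN 23's END of record `o5_index_unit_of_ordinary_companion_cited_s0e` (KL3 part 18 file 2,
`O5/HeegnerLogTransportThreeStepZeroEndRecord.lean`, placed by cc-typer-5 GEN 19) displays, among its
per-row inputs, `htamGd' : Even d_K → 3 ∤ ∏_ℓ c_ℓ(G_d)` for a model `G_d` of the twist of the good-ordinary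
companion `G` by the Heegner field `K` — owed only when `d_K` is even, because the transport
`ord₃ ∏c(G_d) = ord₃ ∏c(G)` was in the tree for odd `d_K` only. Harvest-2's E116′ leaf
`O5/HeegnerTwistTamagawaThree.lean` (p354556) proves the transport for EVERY `d_K` (the place `ℓ = 2 ∣ d_K`
with `G` good at `2` by the tree's discharge of Barrios et al. 2025 Thm. 5.1:
`c₂(G_d) ∈ {1, 2, 4}`), packaged as `TwistTamagawa.not_three_dvd_tamagawaProduct_twist_of_heegner_anyDiscr`
— part 18's `not_three_dvd_tamagawaProduct_twist_of_heegner` with `htamGd'` deleted. Hence: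

* `o5_index_unit_of_ordinary_companion_cited_s0f` — **the END of record with `htamGd'` DELETED**: the
  binders of `…_cited_s0e` verbatim and in the same order, minus `htamGd'`; proof = `…_cited_s0e` fed with
  `htamGd' := fun _ ↦ not_three_dvd_tamagawaProduct_twist_of_heegner_anyDiscr …` (`h3K` from
  `satisfiesHeegnerHypothesis_three_of_addv`, exactly as inside `…_cited_s0e`).

Displayed per-row inputs of the END after this file: the congruence `hcong`, `hρ`, `hadd`, `ht3`/`htℓ`,
`hunitW`/`hunitG`, `htam`/`htamG`, `hordG`, the Heegner points `P`, `P′` non-torsion, the two `3`-descent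
counts + the twist's torsion, `hQW` (`dE = 0`), `hcD`, `hc3'`, `d_K < -4` — and NO Tamagawa datum of the
twist `G_d` at all (C-O5END-COV v3's "Tam(G_d), even `d_K` only" column is empty). Nothing else changes;
no node is touched; the END's name of record is the planner's / typer's word, not this file's.

References: [KrizLi2019] Thm. 1.16, Rem. 1.17; [JetchevSkinnerWan2017] §7.3.1 (eq:tamK), §7.4.1;
[BarriosEtAl2025] Thm. 5.1 (§5 tables, rows `I₀`); [SilvermanAEC2009] Thm. X.4.2(a), Cor. VII.6.2;
[YanZhu2024MainConjNonCM] Thm. 4.15; [GrossZagier1986] Thm. I.6.3; [DiamondShurman2005] Thm. 8.8.1.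
-/

set_option autoImplicit false

noncomputable section

open scoped Classical

open WeierstrassCurve Literature.NumberTheory.EllipticCurves
  Literature.NumberTheory.EllipticCurves.ModularForms
  Literature.NumberTheory.EllipticCurves.Rank1Residual
  Literature.NumberTheory.EllipticCurves.Rank1Residual.Typed
open Summit.BirchSwinnertonDyer.Rank1Residual.X11b (embAt)
open IsDedekindDomain (HeightOneSpectrum)
open Literature.NumberTheory.GaloisCohomology (poitouTate_selmerStructure_duality)
open Literature.NumberTheory.GaloisRepresentations (localEulerPoincareCharacteristic)
open scoped NumberField

namespace Summit.BirchSwinnertonDyer.Rank1Residual.O5.HeegnerLogTransport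

/-- **O5 (t′) END of record, certificate form, with the twist's Tamagawa binder DELETED for every `d_K`
(harvest-2 GEN 59, E116′).** o5-r2 GEN 23's `o5_index_unit_of_ordinary_companion_cited_s0e` with the binder
`htamGd' : Even d_K → 3 ∤ ∏c(G_d)` removed: it is proved from `htamG : 3 ∤ ∏c(G)` for ANY `d_K` by
`TwistTamagawa.not_three_dvd_tamagawaProduct_twist_of_heegner_anyDiscr` (Jetchev–Skinner–Wan §7.3.1
(eq:tamK) prime by prime; at `2 ∣ d_K` Barrios et al. 2025 Thm. 5.1, `c₂(G_d) ∈ {1, 2, 4}`), with `3` split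
in `K` from `hH`, `hadd`, `hmod` (`satisfiesHeegnerHypothesis_three_of_addv`). Displayed per-row inputs:
`hcong`, `hρ`, `hadd`, `ht3`/`htℓ`, `hunitW`/`hunitG`, `htam`/`htamG`, `hordG`, `P`, `P′` non-torsion, the two
`3`-descent counts + the twist's torsion, `hQW`, `hcD`, `hc3'`, `d_K < -4`; every one a decidable certificate
or a published theorem BY NAME. Conclusion `3 ∤ [W(K) : ℤP]`. [cite: KrizLi2019, Thm. 1.16, Rem. 1.17]
[cite: JetchevSkinnerWan2017, §7.3.1 (eq:tamK) and §7.4.1 (arXiv:1512.06894 pp. 29–31)]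
[cite: BarriosEtAl2025, Thm. 5.1 with the rows R = I₀ of the §5 tables] [cite: SilvermanAEC2009, Thm. X.4.2(a)]
[cite: YanZhu2024MainConjNonCM, Thm. 4.15 (§4.6) = Cor. 1.4] [cite: GrossZagier1986, Thm. I.6.3 with V.§2 (pp. 310–312)] -/
theorem o5_index_unit_of_ordinary_companion_cited_s0f
    (hKL : KrizLi2019.thm116_padicLogHeegner_congruence)
    (hPT : ∀ (K : Type) [Field K] [NumberField K], poitouTate_selmerStructure_duality K)
    (hEP : ∀ (K : Type) [Field K] [NumberField K] (v : HeightOneSpectrum (𝓞 K)),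
      localEulerPoincareCharacteristic (v.adicCompletion K))
    (hYZ : YanZhu2026.thm415_padicValRat_bsd_rank_le_one)
    (hW20 : Wuthrich2014.lemma20_surjective_threeAdic_of_semistable)
    (hmod : exists_isNewformOf) (hGZK : rank_eq_analyticRank_of_analyticRank_le_one)
    (W G : WeierstrassCurve ℚ) [W.IsElliptic] [W.IsGloballyMinimal] [G.IsElliptic] [G.IsGloballyMinimal]
    (hcong : ∀ ℓ : ℕ, ℓ.Prime → ¬ (ℓ ∣ 3 * W.conductorNorm ℤ * G.conductorNorm ℤ) →
      ((W.LFunction ℓ : ℤ) : ZMod 3) = ((G.LFunction ℓ : ℤ) : ZMod 3))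
    (hρ : W.HasSurjectiveModNGaloisRep 3) (hadd : Addv W 3) (ht3 : NoLocalThreeTorsionAt W 3)
    (htℓ : ∀ (ℓ : ℕ) [Fact ℓ.Prime], ℓ ≠ 3 → (ℓ : ℤ) ∣ W.conductorNorm ℤ * G.conductorNorm ℤ →
      NoLocalThreeTorsionAt W ℓ)
    (hunitW : ∀ ℓ ∈ klSet W G, ℓ ≠ 3 → padicValInt 3 (nsCount W ℓ) = 0)
    (hunitG : ∀ ℓ ∈ klSet G W, ℓ ≠ 3 → padicValInt 3 (nsCount G ℓ) = 0)
    (htam : ¬ 3 ∣ W.tamagawaProduct) (htamG : ¬ 3 ∣ G.tamagawaProduct) (hordG : GoodOrd G 3)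
    (Gd : WeierstrassCurve ℚ) [Gd.IsElliptic] [Gd.IsGloballyMinimal]
    {N N' : ℕ} [NeZero N] [NeZero N'] (D : ModularParametrizationData W N)
    (D' : ModularParametrizationData G N')
    (K : Type) [Field K] [NumberField K] (hK : IsImaginaryQuadratic K)
    (hH : SatisfiesHeegnerHypothesis N K) (hH' : SatisfiesHeegnerHypothesis N' K)
    (hKoW : kolyvagin N W K) (hKoG : kolyvagin N' G K) (hGZG : gross_zagier N' G K)
    (hd : NumberField.discr K < -4)
    (hGd : ∃ C : VariableChange ℚ, C • G.quadraticTwist (NumberField.discr K : ℚ) = Gd)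
    (H : HeegnerDatum N (NumberField.discr K)) (H' : HeegnerDatum N' (NumberField.discr K))
    (ι : K →+* ℂ) (𝔭 : HeightOneSpectrum (𝓞 K)) (h𝔭 : ((3 : ℕ) : 𝓞 K) ∈ 𝔭.asIdeal)
    (he : 𝔭.asIdeal.ramificationIdx (𝓞 ℚ) = 1) (hf : 𝔭.asIdeal.inertiaDeg (𝓞 ℚ) = 1)
    (P : (W.baseChange K).toAffine.Point) (P' : (G.baseChange K).toAffine.Point)
    (hP : WeierstrassCurve.Affine.Point.map ι.toRatAlgHom P = heegnerPointComplex D H)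
    (hP' : WeierstrassCurve.Affine.Point.map ι.toRatAlgHom P' = heegnerPointComplex D' H')
    (hPinf : ¬ IsOfFinAddOrder P) (hP'inf : ¬ IsOfFinAddOrder P')
    (Wt : WeierstrassCurve ℚ) [Wt.IsElliptic]
    (hWt : ∃ C : VariableChange ℚ, C • W.quadraticTwist (NumberField.discr K : ℚ) = Wt)
    (htorst : ¬ 3 ∣ Wt.torsionOrder)
    (hSelW : Nat.card (W.selmerGroup (3 : ℤ)) = 3 ^ W.mordellWeilRank)
    (hSelWt : Nat.card (Wt.selmerGroup (3 : ℤ)) = 3 ^ Wt.mordellWeilRank)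
    (hQW : ∃ Q : (W.baseChange K).toAffine.Point, ¬ IsOfFinAddOrder Q ∧
      X11b.padicLogOrd W 3 (embAt K 3 𝔭 h𝔭 he hf) Q = 0)
    (hcD : padicValInt 3 D.maninConstant = 0) (hc3' : ¬ ((3 : ℤ) ∣ D'.maninConstant)) :
    padicValNat 3 (AddSubgroup.zmultiples P).index = 0 :=
  have h3K : SatisfiesHeegnerHypothesis 3 K :=
    satisfiesHeegnerHypothesis_three_of_addv hmod W hadd D K hH
  o5_index_unit_of_ordinary_companion_cited_s0e hKL hPT hEP hYZ hW20 hmod hGZK W G hcong hρ hadd ht3 htℓ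
    hunitW hunitG htam htamG hordG Gd D D' K hK hH hH' hKoW hKoG hGZG hd hGd
    (fun _ ↦ TwistTamagawa.not_three_dvd_tamagawaProduct_twist_of_heegner_anyDiscr hmod G Gd D' K hK hH'
      h3K hGd htamG)
    H H' ι 𝔭 h𝔭 he hf P P' hP hP' hPinf hP'inf Wt hWt htorst hSelW hSelWt hQW hcD hc3'

end Summit.BirchSwinnertonDyer.Rank1Residual.O5.HeegnerLogTransport

end
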